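import Summits.ResolutionOfSingularities.ResolutionOfSingularities.Theorems.EigenLadderLU5
import HarnessLib

/-!
# EigenLadderLU5B — decomp-res node «EigenLadder» (lens-1 g24, CRITIC-LEDGER row 187 CLEARED
DECIDED-MOD-D +1 · MAP 0): continuation of `EigenLadderLU5`

PART E2 — the cell and the datum from a BARE `σ`-stable chart (frame COMPUTED by PART B):
`tameKummerChartBelow_of_stableChart`, `galoisHenselDescentDatum_of_stableChart`,
`relLU_of_stableChart`, `galoisHenselDescentDatum_of_stableHyperplane`,
`tameKummerChartBelow_of_stableHyperplane`.

[WRITER NOTE (decomp-res writer g12): the gate caps Theorems files with proofs at 400 lines, so the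
lens's tree file `EigenLadderLU5.lean` (469 l, sha256 08b5d2d1…) is landed as TWO modules split at a
namespace-block boundary — `EigenLadderLU5` (PART D Kummer law + PART E tame Kummer cell, cut mod D,
`closes_kummer`) and `EigenLadderLU5B` (PART E2 bare `σ`-stable chart) — content VERBATIM (plus
bookkeeping docstrings on undocumented simp lemmas); the node's import chain becomes EigenLadderLU →
EigenLadderLU1B → EigenLadderLU2 → EigenLadderLU2B → EigenLadderLU3 → EigenLadderLU4 →
EigenLadderLU5 → EigenLadderLU5B → EigenLadderLU6 (one namespace `…Theorems.EigenLadderLU`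
throughout).]
-/

namespace Summit.ResolutionOfSingularities.ResolutionOfSingularities.Theorems.EigenLadderLU

open Literature.AlgebraicGeometry.Resolution
open Summit.ResolutionOfSingularities.ResolutionOfSingularities.Theorems
open Summit.ResolutionOfSingularities.ResolutionOfSingularities.Theorems.AdaptedChartHensel
open Summit.ResolutionOfSingularities.ResolutionOfSingularities.Theorems.GaloisDescentLU
open Summit.ResolutionOfSingularities.ResolutionOfSingularities.Theorems.KeyChainLU
open Summit.ResolutionOfSingularities.ResolutionOfSingularities.Theorems.HenselKeyChainLU

/-! ## PART E2 — the cell and the datum from a BARE `σ`-stable chart (frame COMPUTED by PART B) -/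

section FrameCell

variable {k : Type} [Field k] {K : Type} [Field K] [Algebra k K]

/-- `restrictScalars_pow_apply`: Bookkeeping / simp lemma of the eigen-ladder kernel (decomp-res lens-1 g24
«EigenLadder»), VERBATIM from the lens's tree file (see the module docstring); the statement is its type. [folklore] -/
theorem restrictScalars_pow_apply {L : Type} [Field L] [Algebra k L] [Algebra K L]
    [IsScalarTower k K L] (σ : L ≃ₐ[K] L) (i : ℕ) (y : L) :
    ((AlgEquiv.restrictScalars k σ) ^ i) y = (σ ^ i) y := by
  induction i with
  | zero => rfl
  | succ i ih => rw [pow_succ_apply, pow_succ_apply, ih]; rfl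

/-- **THE CELL FROM A BARE STABLE CHART (frame not given in advance).**  Upstairs: a finite cyclic tame
Galois `K' | K` (`⟨σ⟩`, `σ^ℓ = 1`, `(ℓ : k) ≠ 0`, `μ_ℓ ⊆ k`), a `σ`-stable residually rational
prolongation `O'`, and a VALUE-ADAPTED REGULAR CHART `(A, u)` of `(K', v')` with `A` `σ`-stable,
`u₁, u₂, u₃` `σ`-fixed and the hyperplane `(u₀)` `⟨σ⟩`-stable with residual eigenvalue `ζ` (cocycle
form).  Then the Reynolds parameter `x₀ = P_ζ(u₀)` makes `(A, x₀, u₁, u₂, u₃)` a tame Kummer chart: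
`TameKummerChartBelow k O`. [CossartPiltant2008, proof of Prop. 6.2 (2), (29)–(30)] [folklore] -/
theorem tameKummerChartBelow_of_stableChart (O : ValuationSubring K)
    (K' : IntermediateField K (AlgebraicClosure K)) [FiniteDimensional K K'] [IsGalois K K']
    (σ : K' ≃ₐ[K] K') (hcyc : ∀ g : K' ≃ₐ[K] K', ∃ i : ℕ, g = σ ^ i)
    {ℓ : ℕ} (hℓ : 0 < ℓ) (hℓk : (ℓ : k) ≠ 0) (hσℓ : σ ^ ℓ = 1) {ζ : k} (hζ : IsPrimitiveRoot ζ ℓ)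
    (O' : ValuationSubring K') (hO'O : O'.comap (algebraMap K K') = O)
    (hσO' : ∀ y : K', y ∈ O' ↔ σ y ∈ O')
    (hκ' : ∀ y ∈ O', ∃ c : k, y - algebraMap k K' c ∈ O'.nonunits)
    (A : Subalgebra k K') (hAO : A.toSubring ≤ O'.toSubring) (hAσ : ∀ a ∈ A, σ a ∈ A)
    (u : Fin 4 → K') (hu : ∀ i, u i ∈ A) (hAfg : A.FG) (hfrac : IsFractionRing A K')
    (hreg : IsRegularLocalRing (Localization.AtPrime (centreIdeal A O' hAO)))
    (hdim : ringKrullDim (Localization.AtPrime (centreIdeal A O' hAO)) = 4)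
    (hmax : IsLocalRing.maximalIdeal (Localization.AtPrime (centreIdeal A O' hAO)) =
      Ideal.span (Set.range fun i =>
        algebraMap A (Localization.AtPrime (centreIdeal A O' hAO)) ⟨u i, hu i⟩))
    (hind : ∀ m : Fin 3 → ℤ, (∏ i : Fin 3, O'.valuation (u (Fin.castSucc i)) ^ m i) = 1 → m = 0)
    (hspan : ∀ z : K', z ≠ 0 → ∃ E : ℕ, 0 < E ∧ ∃ m : Fin 3 → ℤ,
      O'.valuation z ^ E = ∏ i : Fin 3, O'.valuation (u (Fin.castSucc i)) ^ m i)
    (hufix : ∀ i : Fin 3, σ (u i.succ) = u i.succ)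
    (a b : ℕ → K') (haA : ∀ i, i < ℓ → a i ∈ A) (hbA : ∀ i, i < ℓ → b i ∈ A)
    (hb1 : ∀ i, i < ℓ → O'.valuation (b i) = 1)
    (horb : ∀ i, i < ℓ → (σ ^ i) (u 0) * b i = a i * u 0)
    (hres : ∀ i, i < ℓ → O'.valuation (a i - algebraMap k K' (ζ ^ i) * b i) < 1) :
    TameKummerChartBelow k O := by
  let σk : K' ≃ₐ[k] K' := σ.restrictScalars k
  have hσkℓ : σk ^ ℓ = 1 := by
    ext y
    rw [restrictScalars_pow_apply, hσℓ]
    rfl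
  have horbk : ∀ i, i < ℓ → (σk ^ i) (u 0) * b i = a i * u 0 := fun i hi => by
    rw [restrictScalars_pow_apply]; exact horb i hi
  obtain ⟨x, hx, -, hxsucc, hσx0, hxv, hmax'⟩ :=
    kummerFrame_of_stableHyperplane σk hℓ hℓk hσkℓ hζ O' A hAO hAσ u hu hmax a b haA hbA hb1
      horbk hres
  have hprod : ∀ m : Fin 3 → ℤ, (∏ i : Fin 3, O'.valuation (x (Fin.castSucc i)) ^ m i) =
      ∏ i : Fin 3, O'.valuation (u (Fin.castSucc i)) ^ m i := fun m =>
    Finset.prod_congr rfl fun i _ => by rw [hxv]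
  refine ⟨K', ‹_›, ‹_›, σ, hcyc, ℓ, hℓ, hℓk, ζ, hζ, O', hO'O, hσO', hκ', A, hAO, x, hx, hAfg, hfrac,
    hreg, hdim, hmax', fun m hm => hind m (by rw [← hprod, hm]), fun z hz => ?_, hσx0, fun i => ?_⟩
  · obtain ⟨E, hE, m, hm⟩ := hspan z hz
    exact ⟨E, hE, m, by rw [hprod, hm]⟩
  · change σk (x i.succ) = x i.succ
    rw [hxsucc]
    exact hufix i

/-- **(K-e″) WITH THE FRAME COMPUTED** (decided modulo THEOREM D): bare `σ`-stable value-adapted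
regular chart upstairs + tame cyclic `G = G_Z` + stable hyperplane ⇒ `GaloisHenselDescentDatum k O`.
[folklore] -/
theorem galoisHenselDescentDatum_of_stableChart (hD : TheoremD k) (O : ValuationSubring K)
    (hr : Nonempty O.valuation.RankOne)
    (K' : IntermediateField K (AlgebraicClosure K)) [FiniteDimensional K K'] [IsGalois K K']
    (σ : K' ≃ₐ[K] K') (hcyc : ∀ g : K' ≃ₐ[K] K', ∃ i : ℕ, g = σ ^ i)
    {ℓ : ℕ} (hℓ : 0 < ℓ) (hℓk : (ℓ : k) ≠ 0) (hσℓ : σ ^ ℓ = 1) {ζ : k} (hζ : IsPrimitiveRoot ζ ℓ)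
    (O' : ValuationSubring K') (hO'O : O'.comap (algebraMap K K') = O)
    (hσO' : ∀ y : K', y ∈ O' ↔ σ y ∈ O')
    (hκ' : ∀ y ∈ O', ∃ c : k, y - algebraMap k K' c ∈ O'.nonunits)
    (A : Subalgebra k K') (hAO : A.toSubring ≤ O'.toSubring) (hAσ : ∀ a ∈ A, σ a ∈ A)
    (u : Fin 4 → K') (hu : ∀ i, u i ∈ A) (hAfg : A.FG) (hfrac : IsFractionRing A K')
    (hreg : IsRegularLocalRing (Localization.AtPrime (centreIdeal A O' hAO)))
    (hdim : ringKrullDim (Localization.AtPrime (centreIdeal A O' hAO)) = 4)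
    (hmax : IsLocalRing.maximalIdeal (Localization.AtPrime (centreIdeal A O' hAO)) =
      Ideal.span (Set.range fun i =>
        algebraMap A (Localization.AtPrime (centreIdeal A O' hAO)) ⟨u i, hu i⟩))
    (hind : ∀ m : Fin 3 → ℤ, (∏ i : Fin 3, O'.valuation (u (Fin.castSucc i)) ^ m i) = 1 → m = 0)
    (hspan : ∀ z : K', z ≠ 0 → ∃ E : ℕ, 0 < E ∧ ∃ m : Fin 3 → ℤ,
      O'.valuation z ^ E = ∏ i : Fin 3, O'.valuation (u (Fin.castSucc i)) ^ m i)
    (hufix : ∀ i : Fin 3, σ (u i.succ) = u i.succ)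
    (a b : ℕ → K') (haA : ∀ i, i < ℓ → a i ∈ A) (hbA : ∀ i, i < ℓ → b i ∈ A)
    (hb1 : ∀ i, i < ℓ → O'.valuation (b i) = 1)
    (horb : ∀ i, i < ℓ → (σ ^ i) (u 0) * b i = a i * u 0)
    (hres : ∀ i, i < ℓ → O'.valuation (a i - algebraMap k K' (ζ ^ i) * b i) < 1) :
    GaloisHenselDescentDatum k O :=
  galoisHenselDescentDatum_of_tameKummerChartBelow hD O hr
    (tameKummerChartBelow_of_stableChart O K' σ hcyc hℓ hℓk hσℓ hζ O' hO'O hσO' hκ' A hAO hAσ u hu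
      hAfg hfrac hreg hdim hmax hind hspan hufix a b haA hbA hb1 horb hres)

/-- … and hence relative LU at `O` (mod D), from the bare stable chart upstairs. [folklore] -/
theorem relLU_of_stableChart (hD : TheoremD k) (O : ValuationSubring K)
    (hr : Nonempty O.valuation.RankOne)
    (K' : IntermediateField K (AlgebraicClosure K)) [FiniteDimensional K K'] [IsGalois K K']
    (σ : K' ≃ₐ[K] K') (hcyc : ∀ g : K' ≃ₐ[K] K', ∃ i : ℕ, g = σ ^ i)
    {ℓ : ℕ} (hℓ : 0 < ℓ) (hℓk : (ℓ : k) ≠ 0) (hσℓ : σ ^ ℓ = 1) {ζ : k} (hζ : IsPrimitiveRoot ζ ℓ)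
    (O' : ValuationSubring K') (hO'O : O'.comap (algebraMap K K') = O)
    (hσO' : ∀ y : K', y ∈ O' ↔ σ y ∈ O')
    (hκ' : ∀ y ∈ O', ∃ c : k, y - algebraMap k K' c ∈ O'.nonunits)
    (A : Subalgebra k K') (hAO : A.toSubring ≤ O'.toSubring) (hAσ : ∀ a ∈ A, σ a ∈ A)
    (u : Fin 4 → K') (hu : ∀ i, u i ∈ A) (hAfg : A.FG) (hfrac : IsFractionRing A K')
    (hreg : IsRegularLocalRing (Localization.AtPrime (centreIdeal A O' hAO)))
    (hdim : ringKrullDim (Localization.AtPrime (centreIdeal A O' hAO)) = 4)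
    (hmax : IsLocalRing.maximalIdeal (Localization.AtPrime (centreIdeal A O' hAO)) =
      Ideal.span (Set.range fun i =>
        algebraMap A (Localization.AtPrime (centreIdeal A O' hAO)) ⟨u i, hu i⟩))
    (hind : ∀ m : Fin 3 → ℤ, (∏ i : Fin 3, O'.valuation (u (Fin.castSucc i)) ^ m i) = 1 → m = 0)
    (hspan : ∀ z : K', z ≠ 0 → ∃ E : ℕ, 0 < E ∧ ∃ m : Fin 3 → ℤ,
      O'.valuation z ^ E = ∏ i : Fin 3, O'.valuation (u (Fin.castSucc i)) ^ m i)
    (hufix : ∀ i : Fin 3, σ (u i.succ) = u i.succ)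
    (a b : ℕ → K') (haA : ∀ i, i < ℓ → a i ∈ A) (hbA : ∀ i, i < ℓ → b i ∈ A)
    (hb1 : ∀ i, i < ℓ → O'.valuation (b i) = 1)
    (horb : ∀ i, i < ℓ → (σ ^ i) (u 0) * b i = a i * u 0)
    (hres : ∀ i, i < ℓ → O'.valuation (a i - algebraMap k K' (ζ ^ i) * b i) < 1) :
    RelLocalUniformization k K O :=
  relLU_of_galoisHenselDescent
    (galoisHenselDescentDatum_of_stableChart hD O hr K' σ hcyc hℓ hℓk hσℓ hζ O' hO'O hσO' hκ' A hAO
      hAσ u hu hAfg hfrac hreg hdim hmax hind hspan hufix a b haA hbA hb1 horb hres)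

/-- **(K-e″) IN ONE-STEP FORM — the headline law of this node (decided modulo THEOREM D).**
UPSTAIRS: a finite cyclic tame Galois `K' | K` (`G = ⟨σ⟩`, `σ^ℓ = 1`, `(ℓ : k) ≠ 0`, `μ_ℓ ⊆ k`), a
`G`-stable (`G = G_Z`) residually `k`-rational prolongation `O'` of `O`, and a BARE value-adapted regular
chart `(A, u₀, …, u₃)` of `(K', v')` (THEOREM H's hypothesis verbatim) with `A` `σ`-stable, `u₁, u₂, u₃`
fixed by `σ` and the hyperplane `(u₀)` `σ`-stable with residual eigenvalue `ζ` (ONE relation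
`σ(u₀) b₁ = a₁ u₀`, `a₁ ≡ ζ b₁`, `b₁` a unit).  DOWNSTAIRS: `GaloisHenselDescentDatum k O` — the eigen-frame
`x₀ = P_ζ(u₀)` is COMPUTED (PART B), the sub-top `F₁ = k(x₀^ℓ, u₁, u₂, u₃)` is the field of invariant
monomials (PART C), key-chain by THEOREM D, and `K' = F₁(x₀)(η')` Hensel-simple (PART D).
[CossartPiltant2008, Prop. 6.2, Thm. 6.5] [Grothendieck1967, Prop. 18.4.6 (ii)] [folklore] -/
theorem galoisHenselDescentDatum_of_stableHyperplane (hD : TheoremD k) (O : ValuationSubring K)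
    (hr : Nonempty O.valuation.RankOne)
    (K' : IntermediateField K (AlgebraicClosure K)) [FiniteDimensional K K'] [IsGalois K K']
    (σ : K' ≃ₐ[K] K') (hcyc : ∀ g : K' ≃ₐ[K] K', ∃ i : ℕ, g = σ ^ i)
    {ℓ : ℕ} (hℓ : 0 < ℓ) (hℓk : (ℓ : k) ≠ 0) (hσℓ : σ ^ ℓ = 1) {ζ : k} (hζ : IsPrimitiveRoot ζ ℓ)
    (O' : ValuationSubring K') (hO'O : O'.comap (algebraMap K K') = O)
    (hσO' : ∀ y : K', y ∈ O' ↔ σ y ∈ O')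
    (hκ' : ∀ y ∈ O', ∃ c : k, y - algebraMap k K' c ∈ O'.nonunits)
    (A : Subalgebra k K') (hAO : A.toSubring ≤ O'.toSubring) (hAσ : ∀ a ∈ A, σ a ∈ A)
    (u : Fin 4 → K') (hu : ∀ i, u i ∈ A) (hAfg : A.FG) (hfrac : IsFractionRing A K')
    (hreg : IsRegularLocalRing (Localization.AtPrime (centreIdeal A O' hAO)))
    (hdim : ringKrullDim (Localization.AtPrime (centreIdeal A O' hAO)) = 4)
    (hmax : IsLocalRing.maximalIdeal (Localization.AtPrime (centreIdeal A O' hAO)) =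
      Ideal.span (Set.range fun i =>
        algebraMap A (Localization.AtPrime (centreIdeal A O' hAO)) ⟨u i, hu i⟩))
    (hind : ∀ m : Fin 3 → ℤ, (∏ i : Fin 3, O'.valuation (u (Fin.castSucc i)) ^ m i) = 1 → m = 0)
    (hspan : ∀ z : K', z ≠ 0 → ∃ E : ℕ, 0 < E ∧ ∃ m : Fin 3 → ℤ,
      O'.valuation z ^ E = ∏ i : Fin 3, O'.valuation (u (Fin.castSucc i)) ^ m i)
    (hufix : ∀ i : Fin 3, σ (u i.succ) = u i.succ)
    (a₁ b₁ : K') (ha₁ : a₁ ∈ A) (hb₁ : b₁ ∈ A) (hb₁1 : O'.valuation b₁ = 1)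
    (hstep : σ (u 0) * b₁ = a₁ * u 0)
    (hres₁ : O'.valuation (a₁ - algebraMap k K' ζ * b₁) < 1) :
    GaloisHenselDescentDatum k O := by
  obtain ⟨a, b, haA, hbA, hb1, horb, hres⟩ :=
    orbitCocycle_of_step (σ.restrictScalars k) O' hσO' A hAO hAσ (u 0) ζ a₁ b₁ ha₁ hb₁ hb₁1 hstep hres₁
  exact galoisHenselDescentDatum_of_stableChart hD O hr K' σ hcyc hℓ hℓk hσℓ hζ O' hO'O hσO' hκ' A hAO
    hAσ u hu hAfg hfrac hreg hdim hmax hind hspan hufix a b (fun i _ => haA i) (fun i _ => hbA i)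
    (fun i _ => hb1 i) (fun i _ => by rw [← restrictScalars_pow_apply (k := k)]; exact horb i)
    (fun i _ => hres i)

/-- … and the TAME KUMMER CELL holds at `O` (hypothesis-free in THEOREM D: the cell is a statement about
charts, not about LU downstairs). [folklore] -/
theorem tameKummerChartBelow_of_stableHyperplane (O : ValuationSubring K)
    (K' : IntermediateField K (AlgebraicClosure K)) [FiniteDimensional K K'] [IsGalois K K']
    (σ : K' ≃ₐ[K] K') (hcyc : ∀ g : K' ≃ₐ[K] K', ∃ i : ℕ, g = σ ^ i)
    {ℓ : ℕ} (hℓ : 0 < ℓ) (hℓk : (ℓ : k) ≠ 0) (hσℓ : σ ^ ℓ = 1) {ζ : k} (hζ : IsPrimitiveRoot ζ ℓ)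
    (O' : ValuationSubring K') (hO'O : O'.comap (algebraMap K K') = O)
    (hσO' : ∀ y : K', y ∈ O' ↔ σ y ∈ O')
    (hκ' : ∀ y ∈ O', ∃ c : k, y - algebraMap k K' c ∈ O'.nonunits)
    (A : Subalgebra k K') (hAO : A.toSubring ≤ O'.toSubring) (hAσ : ∀ a ∈ A, σ a ∈ A)
    (u : Fin 4 → K') (hu : ∀ i, u i ∈ A) (hAfg : A.FG) (hfrac : IsFractionRing A K')
    (hreg : IsRegularLocalRing (Localization.AtPrime (centreIdeal A O' hAO)))
    (hdim : ringKrullDim (Localization.AtPrime (centreIdeal A O' hAO)) = 4)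
    (hmax : IsLocalRing.maximalIdeal (Localization.AtPrime (centreIdeal A O' hAO)) =
      Ideal.span (Set.range fun i =>
        algebraMap A (Localization.AtPrime (centreIdeal A O' hAO)) ⟨u i, hu i⟩))
    (hind : ∀ m : Fin 3 → ℤ, (∏ i : Fin 3, O'.valuation (u (Fin.castSucc i)) ^ m i) = 1 → m = 0)
    (hspan : ∀ z : K', z ≠ 0 → ∃ E : ℕ, 0 < E ∧ ∃ m : Fin 3 → ℤ,
      O'.valuation z ^ E = ∏ i : Fin 3, O'.valuation (u (Fin.castSucc i)) ^ m i)
    (hufix : ∀ i : Fin 3, σ (u i.succ) = u i.succ)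
    (a₁ b₁ : K') (ha₁ : a₁ ∈ A) (hb₁ : b₁ ∈ A) (hb₁1 : O'.valuation b₁ = 1)
    (hstep : σ (u 0) * b₁ = a₁ * u 0)
    (hres₁ : O'.valuation (a₁ - algebraMap k K' ζ * b₁) < 1) :
    TameKummerChartBelow k O := by
  obtain ⟨a, b, haA, hbA, hb1, horb, hres⟩ :=
    orbitCocycle_of_step (σ.restrictScalars k) O' hσO' A hAO hAσ (u 0) ζ a₁ b₁ ha₁ hb₁ hb₁1 hstep hres₁
  exact tameKummerChartBelow_of_stableChart O K' σ hcyc hℓ hℓk hσℓ hζ O' hO'O hσO' hκ' A hAO hAσ u hu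
    hAfg hfrac hreg hdim hmax hind hspan hufix a b (fun i _ => haA i) (fun i _ => hbA i)
    (fun i _ => hb1 i) (fun i _ => by rw [← restrictScalars_pow_apply (k := k)]; exact horb i)
    (fun i _ => hres i)

end FrameCell

end Summit.ResolutionOfSingularities.ResolutionOfSingularities.Theorems.EigenLadderLU
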